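import Summits.CriticalPhenomena.PercolationContinuityZ3.Theorems.Transplant.Slab111HubXT12R1
import Summits.CriticalPhenomena.PercolationContinuityZ3.Theorems.Transplant.Slab111HubXT12R2
import Summits.CriticalPhenomena.PercolationContinuityZ3.Theorems.Transplant.Slab111HubXT12R3
import Summits.CriticalPhenomena.PercolationContinuityZ3.Theorems.Transplant.Slab111HubXT12R4
import Summits.CriticalPhenomena.PercolationContinuityZ3.Theorems.Transplant.Slab111HubXLink
import HarnessLib

/-!
# The ZONE-FREE dispatcher of the `(111)`-films — all certificates of the shape `T12` and the node `xlinkage_T12` at its block types (`k ≥ 10`)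

builds on p205010 (kernel theorem, internal audit signed; external expert review pending) — NOT used in this file.  Lane `prim-bschramm`, seat
`prim-bschramm-p2` (gen 37; class C1b; memo `HOME/bschramm/P2-LATTICES.md` §135); helper file (`--supports stmt-CriticalPhenomena-4575 --as helper`).
**`xcerts_T12`** collects the kernel-checked row certificates (files `Slab111HubXT12P*`, `…R*`); **`xlinkage_T12`** =
«Slab111HubXLink».`linkage_of_certsX` for the shape at every block type of its family, for every thickness `k ≥ 10`.
[cite: DuminilCopinSidoraviciusTassion2016, §2.3 (proof of Fact 2: the three disjoint paths γ_u, γ_v, γ_w in B_R(z))]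
-/

noncomputable section

namespace Summit.CriticalPhenomena.PercolationContinuityZ3.Theorems.Transplant

open Literature.Probability.Percolation Literature.Probability.LatticeModels SimpleGraph

namespace Slab111

/-- **All row certificates of shape `T12`.** [folklore] -/
theorem xcerts_T12 : ∀ q₁ ∈ ecolsOf shapeT12, ∀ q₂ ∈ ecolsOf shapeT12, ∃ (pool : List ℕ) (Ns : List (List ℕ)), certRowOK shapeT12 10 q₁ q₂ pool Ns = true := by
  intro q₁ h₁
  have h₁' : q₁ ∈ ([(1, 0), (0, -1), (-1, 1), (-1, 0), (0, 1), (1, -1), (0, -2), (-2, 2), (-2, 0), (0, 2), (1, 1), (1, -2), (-1, -1), (-2, 1), (-1, 2), (-3, 0), (-3, 1), (-3, 2), (-3, 3), (-2, -1), (-2, 3), (-1, -2), (-1, 3), (0, -3), (0, 3), (1, -3), (1, 2)] : List (ℤ × ℤ)) := h₁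
  simp only [List.mem_cons, List.not_mem_nil, or_false] at h₁'
  rcases h₁' with rfl | rfl | rfl | rfl | rfl | rfl | rfl | rfl | rfl | rfl | rfl | rfl | rfl | rfl | rfl | rfl | rfl | rfl | rfl | rfl | rfl | rfl | rfl | rfl | rfl | rfl | rfl
  · exact xrowsT12_1
  · exact xrowsT12_2
  · exact xrowsT12_3
  · exact xrowsT12_4
  · exact xrowsT12_5
  · exact xrowsT12_6
  · exact xrowsT12_7
  · exact xrowsT12_8
  · exact xrowsT12_9
  · exact xrowsT12_10
  · exact xrowsT12_11
  · exact xrowsT12_12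
  · exact xrowsT12_13
  · exact xrowsT12_14
  · exact xrowsT12_15
  · exact xrowsT12_16
  · exact xrowsT12_17
  · exact xrowsT12_18
  · exact xrowsT12_19
  · exact xrowsT12_20
  · exact xrowsT12_21
  · exact xrowsT12_22
  · exact xrowsT12_23
  · exact xrowsT12_24
  · exact xrowsT12_25
  · exact xrowsT12_26
  · exact xrowsT12_27

/-- **THE NODE AT THE BLOCK TYPES OF SHAPE `T12`** (`k ≥ 10`): shaped local linkage from the zone-free certificates. [cite: DuminilCopinSidoraviciusTassion2016, §2.3 (proof of Fact 2: the three disjoint paths γ_u, γ_v, γ_w in B_R(z))] -/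
theorem xlinkage_T12 {k : ℕ} (hk : 10 ≤ k) (z : Site 2) {tD sR sD : ℕ} (htD : tD = 2) (hsR : 3 ≤ sR) (hsD : sR ≤ sD) :
    ∃ W : Set (slab111 k), (∀ x ∈ W, (hexShadow k).sh x ∈ blkR 3 z tD sD) ∧
      (∀ x, (hexShadow k).sh x ∈ hexBall z 1 → (hexShadow k).sh x ∈ blkR 3 z tD sD → x ∈ W) ∧
      ∀ (E₁ E₂ w' : slab111 k), (hexShadow k).Terminals 3 z 1 tD sR W E₁ E₂ w' →
        ∃ r₁ r₂ : VRouteData (film k) (W ∩ (hexShadow k).lift (blkR 3 z 1 sR)) W E₁ E₂ w', r₁.y = r₂.b ∧ r₁.b = r₂.y :=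
  linkage_of_certsX (kmin := 10) (by exact_mod_cast hk) (shapeT12_valid htD hsR hsD) xcerts_T12 z

end Slab111

end Summit.CriticalPhenomena.PercolationContinuityZ3.Theorems.Transplant

end
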